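import Summits.KontsevichZagierPeriods.KontsevichZagierPeriods.Theses.IsogenyCertificates
import Summits.KontsevichZagierPeriods.KontsevichZagierPeriods.Theorems.IsogenyCertificatesXMapKernelStubClassReduction
import Summits.KontsevichZagierPeriods.KontsevichZagierPeriods.Theorems.IsogenyCertificatesXMapPeriodTransferStubCubicComponents
import Summits.KontsevichZagierPeriods.KontsevichZagierPeriods.Theorems.IsogenyCertificatesXMapKernelStubEtaIndependenceAux
import Literature.NumberTheory.Transcendental.ManyCurvePeriodsIsotypicProofs

/-!
# `XMapKernel`, line `derived-datum-quasi-periods` — stub `stub_etaIndependence` (conditional part)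

Support file for the crux `IsogenyCertificates.XMapKernel` (stmt-KontsevichZagierPeriods-10663),
line `derived-datum-quasi-periods`, stub `stub_etaIndependence`: the TRANSCENDENCE INPUT of the
`(ω, η)`-egg cell. For finitely many three-real-root integral cubics `Pᵢ = x³ + Aᵢx + Bᵢ`
(egg `Eᵢ = {Pᵢ > 0} ∖ (unbounded component) = (e₃, e₂)`), pairwise NOT joined by an egg-regular
coprime x-rational isogeny datum, the real periods `Ωᵢ = ∫_{Eᵢ} dx/√Pᵢ` and real quasi-periods
`Hᵢ = ∫_{Eᵢ} x dx/√Pᵢ` are `ℚ`-linearly independent.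

**What is landed here (`stub_etaIndependence_of`).** The registered conclusion, CONDITIONALLY on
(i) the tree's named fact `Literature.NumberTheory.Transcendental.HuberWustholzManyCurvePeriods`
(Huber–Wüstholz 2022, Thm. 15.3 with quasi-periods — Wüstholz's analytic subgroup theorem;
UNPROVED in the tree), and on two explicit, self-contained bookkeeping statements written inline
as hypotheses: (ii) *class independence* — for finitely many pairwise ISOGENOUS lattices with
rational invariants but pairwise WITHOUT rational multiplier, the non-zero real lattice vectors
`Ωⱼ = aⱼω₁ + bⱼω₂` together with their quasi-periods `η(Ωⱼ) = aⱼη₁ + bⱼη₂` are `ℚ`-linearly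
independent (Masser's theorems II/III inside one isogeny class, the quasi-period transport
`IsotypicSplitting.quasiPeriod_transport`, real/imaginary multipliers with `γ² ∈ ℚ`, and the
linear independence of radicals — the `(ω, η)`-version of the previous line's landed `ω`-only stubs
`stub_nonCMClass` / `stub_cmClass`); (iii) *the bridge* — a rational lattice multiplier between
the period lattices of two three-real-root integral curves yields an egg-regular COPRIME datum in
one of the two directions (divide the multiplier by `2` until the `ℚ`-isogeny `φ(z) = cz` is not
divisible by `[2]`; then `φ` or its dual maps egg onto egg, i.e. its kernel misses the egg, i.e.
its Vélu `x`-map denominator has no zero on the closed egg).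

**What is PROVED here** (everything else): (a) the real period lattice `Λᵢ` of `y² = Pᵢ`
(`g₂ = −4Aᵢ`, `g₃ = −4Bᵢ`, a real rectangular lattice) and the identification of the egg of the
signature with the bounded component `{x < e₁ | 4Pᵢ > 0}` of the tree's real-period files
(`egg_eq`, via the sibling stub `stub_cubicComponents`); (b) `Ωᵢ = Ω₀(Λᵢ)`, the least positive
real period (`egg_integral_inv_sqrt`, from the tree's `IsReal.integral_inv_sqrt_cubic_of_discr_pos_eq`)
and `Hᵢ = −η(Ω₀(Λᵢ)) = −(aᵢη₁ + bᵢη₂)` for `Ω₀ = aᵢω₁ + bᵢω₂` (`egg_integral_mul_inv_sqrt`, from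
the CLASSICAL quasi-period formula `∫_{e₃}^{e₂} x dx/√f = −ζ(Ω₀/2)`, Lawden §6.12, which the tree
lacked and which is PROVED in the companion file `…StubEtaIndependenceAux`); (c) the relation
`∑ᵢ (pᵢΩᵢ + qᵢHᵢ) = 0` becomes a `ℚ`-relation among `ω₁⁽ⁱ⁾, ω₂⁽ⁱ⁾, η₁⁽ⁱ⁾, η₂⁽ⁱ⁾`, which the
isotypic splitting `HuberWustholzIsotypicSplitting_of_manyCurvePeriods` (PROVED in the tree from
the named fact (i)) splits along lattice-isogeny classes; (d) inside a class, (iii) and the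
"not joined in either direction" hypothesis exclude rational multipliers, and (ii) concludes.

References: Huber–Wüstholz, *Transcendence and linear relations of 1-periods* (2022), Thm. 15.3;
Baker–Wüstholz (2007) §6.2 Thm. 6.4; Masser, LNM 437 (1975), Thms. II, III and Lemma 3.1;
Lawden, *Elliptic Functions and Applications* (1989), §6.11–§6.13; Silverman AEC VI.5.1, C.16.
-/

noncomputable section

namespace Summit.KontsevichZagierPeriods.IsogenyCertificates.XMapKernelStubs.EtaIndependence

open scoped BigOperators
open Polynomial Set MeasureTheory
open Literature.NumberTheory.Transcendental
open Summit.KontsevichZagierPeriods.IsogenyCertificates.EffectiveXMapChainsNegative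

variable {A B : ℤ} {L : PeriodPair}

/-! ### The egg of `x³ + Ax + B` and the bounded component of the real period lattice -/

/-- `re g₂ = −4A` for a lattice with `g₂ = −4A`. [folklore] -/
theorem g₂_re (hg₂ : L.g₂ = -4 * (A : ℂ)) : L.g₂.re = -4 * (A : ℝ) := by
  rw [hg₂]; simp

/-- `re g₃ = −4B` for a lattice with `g₃ = −4B`. [folklore] -/
theorem g₃_re (hg₃ : L.g₃ = -4 * (B : ℂ)) : L.g₃.re = -4 * (B : ℝ) := by
  rw [hg₃]; simp

/-- `4x³ − g₂x − g₃ = 4(x³ + Ax + B)` when `g₂ = −4A`, `g₃ = −4B`. [folklore] -/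
theorem four_mul_cubic (hg₂ : L.g₂ = -4 * (A : ℂ)) (hg₃ : L.g₃ = -4 * (B : ℂ)) (x : ℝ) :
    4 * x ^ 3 - L.g₂.re * x - L.g₃.re = 4 * (x ^ 3 + (A : ℝ) * x + (B : ℝ)) := by
  rw [g₂_re hg₂, g₃_re hg₃]; ring

/-- Three real roots: `g₂³ − 27g₃² = −16(4A³ + 27B²) > 0`. [folklore] -/
theorem discr_pos (h : 4 * A ^ 3 + 27 * B ^ 2 < 0) (hg₂ : L.g₂ = -4 * (A : ℂ))
    (hg₃ : L.g₃ = -4 * (B : ℂ)) : 0 < L.g₂.re ^ 3 - 27 * L.g₃.re ^ 2 := by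
  rw [g₂_re hg₂, g₃_re hg₃]
  have : ((4 * A ^ 3 + 27 * B ^ 2 : ℤ) : ℝ) < 0 := by exact_mod_cast h
  push_cast at this
  nlinarith

/-- **The egg is the bounded component of the real period lattice.** For `4A³ + 27B² < 0` and
the real lattice `Λ` with `g₂ = −4A`, `g₃ = −4B`: the egg
`{P > 0} ∖ (component of 1 + |A| + |B|)` of `P = x³ + Ax + B` equals `{x < e₁ | 4P(x) > 0}`,
`e₁ = ℘(Ω₀/2)` — `e₁` is the largest root of `P` (`4P > 0` beyond it), the other two roots are
`(−e₁ ± √(g₂ − 3e₁²))/2 < e₁`, and an interval between consecutive roots on which `P > 0` is the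
egg (`stub_cubicComponents`). [folklore] -/
theorem egg_eq (h : 4 * A ^ 3 + 27 * B ^ 2 < 0) (hg₂ : L.g₂ = -4 * (A : ℂ))
    (hg₃ : L.g₃ = -4 * (B : ℂ)) (hreal : L.IsReal) :
    {y : ℝ | 0 < y ^ 3 + (A : ℝ) * y + (B : ℝ)} \
        connectedComponentIn {y : ℝ | 0 < y ^ 3 + (A : ℝ) * y + (B : ℝ)}
          (1 + |(A : ℝ)| + |(B : ℝ)|) =
      {x : ℝ | 0 < 4 * x ^ 3 - L.g₂.re * x - L.g₃.re ∧
        x < L.weierstrassPRe (L.minRealPeriod / 2)} := by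
  set e₁ := L.weierstrassPRe (L.minRealPeriod / 2) with he₁_def
  have hdisc := discr_pos h hg₂ hg₃
  have hf := four_mul_cubic hg₂ hg₃
  have he₁ : 4 * e₁ ^ 3 - L.g₂.re * e₁ - L.g₃.re = 0 := hreal.cubic_weierstrassPRe_half
  have hright : ∀ x, e₁ < x → 0 < 4 * x ^ 3 - L.g₂.re * x - L.g₃.re :=
    fun x hx ↦ hreal.cubic_pos_of_lt hx
  have h12 : 12 * e₁ ^ 2 - L.g₂.re ≠ 0 := by
    intro h0
    rw [PeriodPair.cubic_discr_eq_of_root he₁, h0] at hdisc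
    simp at hdisc
  have hD : 0 < L.g₂.re - 3 * e₁ ^ 2 := by
    rw [PeriodPair.cubic_discr_eq_of_root he₁] at hdisc
    exact pos_of_mul_pos_left hdisc (sq_nonneg _)
  set s := Real.sqrt (L.g₂.re - 3 * e₁ ^ 2) with hs
  have hs2 : s ^ 2 = L.g₂.re - 3 * e₁ ^ 2 := Real.sq_sqrt hD.le
  have hs0 : 0 < s := Real.sqrt_pos.mpr hD
  have hr₁ : 4 * ((-e₁ + s) / 2) ^ 3 - L.g₂.re * ((-e₁ + s) / 2) - L.g₃.re = 0 := by
    rw [PeriodPair.cubic_eq_mul_of_root he₁]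
    have : 4 * ((-e₁ + s) / 2) ^ 2 + 4 * e₁ * ((-e₁ + s) / 2) + (4 * e₁ ^ 2 - L.g₂.re) = 0 := by
      linear_combination hs2
    rw [this, mul_zero]
  have hr₂ : 4 * ((-e₁ - s) / 2) ^ 3 - L.g₂.re * ((-e₁ - s) / 2) - L.g₃.re = 0 := by
    rw [PeriodPair.cubic_eq_mul_of_root he₁]
    have : 4 * ((-e₁ - s) / 2) ^ 2 + 4 * e₁ * ((-e₁ - s) / 2) + (4 * e₁ ^ 2 - L.g₂.re) = 0 := by
      linear_combination hs2
    rw [this, mul_zero]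
  have hlt : (-e₁ - s) / 2 < (-e₁ + s) / 2 := by linarith
  have hne₁ : (-e₁ + s) / 2 ≠ e₁ := by
    intro heq
    apply h12
    have h3 : s = 3 * e₁ := by linarith
    linear_combination hs2 - (s + 3 * e₁) * h3
  have hlt₁ : (-e₁ + s) / 2 < e₁ := by
    rcases lt_trichotomy ((-e₁ + s) / 2) e₁ with hh | hh | hh
    · exact hh
    · exact absurd hh hne₁
    · exact absurd hr₁ (hright _ hh).ne'
  have hprod := PeriodPair.cubic_eq_prod_of_roots hlt.ne (hlt.trans hlt₁).ne hne₁ hr₂ hr₁ he₁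
  rw [PeriodPair.setOf_cubic_pos_lt_eq_Ioo hlt hlt₁ hprod]
  have hP : ∀ x, x ^ 3 + (A : ℝ) * x + (B : ℝ) =
      (x - (-e₁ - s) / 2) * (x - (-e₁ + s) / 2) * (x - e₁) := by
    intro x
    have := hprod x
    rw [hf] at this
    linarith
  have hroot₂ : ((-e₁ - s) / 2) ^ 3 + (A : ℝ) * ((-e₁ - s) / 2) + (B : ℝ) = 0 := by
    rw [hP]; ring
  have hroot₁ : ((-e₁ + s) / 2) ^ 3 + (A : ℝ) * ((-e₁ + s) / 2) + (B : ℝ) = 0 := by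
    rw [hP]; ring
  have hIoo : Ioo ((-e₁ - s) / 2) ((-e₁ + s) / 2) ⊆
      {y : ℝ | 0 < y ^ 3 + (A : ℝ) * y + (B : ℝ)} := by
    intro x hx
    simp only [mem_setOf_eq]
    rw [hP]
    have h1 : 0 < x - (-e₁ - s) / 2 := by linarith [hx.1]
    have h2 : x - (-e₁ + s) / 2 < 0 := by linarith [hx.2]
    have h3 : x - e₁ < 0 := by linarith [hx.2]
    exact mul_pos_of_neg_of_neg (mul_neg_of_pos_of_neg h1 h2) h3
  exact ((XMapPeriodTransferCells.stub_cubicComponents A B (ne_of_lt h) _ rfl _ hroot₂).2 _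
    hroot₁ hlt hIoo).symm

/-! ### The egg integrals: `Ω_egg = Ω₀(Λ)` and `H_egg = −η(Ω₀(Λ))` -/

/-- Transport of a set integral along `ℝ¹ = (Fin 1 → ℝ) ≃ ℝ` (`MeasurableEquiv.funUnique`).
[folklore] -/
theorem setIntegral_fin_one (F : ℝ → ℝ) (E : Set ℝ) :
    ∫ x in {x : Fin 1 → ℝ | x 0 ∈ E}, F (x 0) = ∫ y in E, F y :=
  (MeasureTheory.volume_preserving_funUnique (Fin 1) ℝ).setIntegral_preimage_emb
    (MeasurableEquiv.measurableEmbedding _) F E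

/-- **`Ω_egg = Ω₀`**: for `4A³ + 27B² < 0` and the real lattice with `g₂ = −4A`, `g₃ = −4B`,
`∫_egg dx/√(x³ + Ax + B) = Ω₀(Λ)`, the least positive real period (`1/√P = 2/√(4P)` and the
tree's `∫_{e₃}^{e₂} dx/√(4P) = Ω₀/2`, Lawden (6.12.18)). [folklore] -/
theorem egg_integral_inv_sqrt (h : 4 * A ^ 3 + 27 * B ^ 2 < 0) (hg₂ : L.g₂ = -4 * (A : ℂ))
    (hg₃ : L.g₃ = -4 * (B : ℂ)) (hreal : L.IsReal) :
    (∫ x in {x : Fin 1 → ℝ | x 0 ∈ {y : ℝ | 0 < y ^ 3 + (A : ℝ) * y + (B : ℝ)} \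
        connectedComponentIn {y : ℝ | 0 < y ^ 3 + (A : ℝ) * y + (B : ℝ)}
          (1 + |(A : ℝ)| + |(B : ℝ)|)},
        1 / Real.sqrt (x 0 ^ 3 + (A : ℝ) * x 0 + (B : ℝ))) = L.minRealPeriod := by
  rw [setIntegral_fin_one (fun y ↦ 1 / Real.sqrt (y ^ 3 + (A : ℝ) * y + (B : ℝ))),
    egg_eq h hg₂ hg₃ hreal]
  have hpt : ∀ y : ℝ, 1 / Real.sqrt (y ^ 3 + (A : ℝ) * y + (B : ℝ)) =
      2 * (Real.sqrt (4 * y ^ 3 - L.g₂.re * y - L.g₃.re))⁻¹ := by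
    intro y
    rw [four_mul_cubic hg₂ hg₃ y, sqrt_four_mul]
    by_cases h0 : Real.sqrt (y ^ 3 + (A : ℝ) * y + (B : ℝ)) = 0
    · simp [h0]
    · field_simp
  simp_rw [hpt]
  rw [integral_const_mul, hreal.integral_inv_sqrt_cubic_of_discr_pos_eq (discr_pos h hg₂ hg₃)]
  ring

/-- **`H_egg = −η(Ω₀)`**: for `4A³ + 27B² < 0`, the real lattice with `g₂ = −4A`, `g₃ = −4B` and
integer coordinates `Ω₀ = aω₁ + bω₂` of its least positive real period,
`∫_egg x dx/√(x³ + Ax + B) = −(aη₁ + bη₂)` (`x/√P = 2x/√(4P)`, the quasi-period formula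
`∫_{e₃}^{e₂} x dx/√(4P) = −ζ(Ω₀/2)` of the companion file, and `2ζ(Ω₀/2) = aη₁ + bη₂`).
[folklore] -/
theorem egg_integral_mul_inv_sqrt (h : 4 * A ^ 3 + 27 * B ^ 2 < 0) (hg₂ : L.g₂ = -4 * (A : ℂ))
    (hg₃ : L.g₃ = -4 * (B : ℂ)) (hreal : L.IsReal) {a b : ℤ}
    (hab : (a : ℂ) * L.ω₁ + (b : ℂ) * L.ω₂ = (L.minRealPeriod : ℂ)) :
    (((∫ x in {x : Fin 1 → ℝ | x 0 ∈ {y : ℝ | 0 < y ^ 3 + (A : ℝ) * y + (B : ℝ)} \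
        connectedComponentIn {y : ℝ | 0 < y ^ 3 + (A : ℝ) * y + (B : ℝ)}
          (1 + |(A : ℝ)| + |(B : ℝ)|)},
        x 0 / Real.sqrt (x 0 ^ 3 + (A : ℝ) * x 0 + (B : ℝ)) : ℝ) : ℂ)) =
      -((a : ℂ) * L.η₁ + (b : ℂ) * L.η₂) := by
  rw [setIntegral_fin_one (fun y ↦ y / Real.sqrt (y ^ 3 + (A : ℝ) * y + (B : ℝ))),
    egg_eq h hg₂ hg₃ hreal]
  have hpt : ∀ y : ℝ, y / Real.sqrt (y ^ 3 + (A : ℝ) * y + (B : ℝ)) =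
      2 * (y * (Real.sqrt (4 * y ^ 3 - L.g₂.re * y - L.g₃.re))⁻¹) := by
    intro y
    rw [four_mul_cubic hg₂ hg₃ y, sqrt_four_mul]
    by_cases h0 : Real.sqrt (y ^ 3 + (A : ℝ) * y + (B : ℝ)) = 0
    · simp [h0]
    · field_simp
  simp_rw [hpt]
  rw [integral_const_mul, Complex.ofReal_mul,
    integral_mul_inv_sqrt_cubic_of_discr_pos L hreal (discr_pos h hg₂ hg₃),
    show ((L.minRealPeriod / 2 : ℝ) : ℂ) = (L.minRealPeriod : ℂ) / 2 by push_cast; ring]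
  have key := two_mul_weierstrassZeta_half_lattice L a b
  rw [show ((a : ℂ) * L.ω₁ + b * L.ω₂) / 2 = (L.minRealPeriod : ℂ) / 2 by rw [hab]] at key
  push_cast
  linear_combination -key

/-! ### The conditional η-independence -/

/-- **η-independence, conditional form** (stub `stub_etaIndependence` of the line
`derived-datum-quasi-periods`, crux `XMapKernel`). HYPOTHESES, in order: (1) the tree's named
fact `HuberWustholzManyCurvePeriods` (Huber–Wüstholz 2022 Thm. 15.3 with quasi-periods; unproved
in the tree); (2) CLASS INDEPENDENCE — for finitely many pairwise isogenous lattices with rational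
invariants and pairwise without rational multiplier, non-zero real lattice vectors
`Ωⱼ = aⱼω₁ + bⱼω₂` and their quasi-periods `aⱼη₁ + bⱼη₂` are `ℚ`-linearly independent (Masser
II/III in one class + quasi-period transport + twist bookkeeping; the `(ω, η)`-version of the
landed `stub_nonCMClass`/`stub_cmClass`); (3) THE BRIDGE — a rational lattice multiplier between
the period lattices (`g₂ = −4A`, `g₃ = −4B`) of two three-real-root integral curves gives an
egg-regular coprime x-rational isogeny datum in one of the two directions (an isogeny not
divisible by `[2]`, or its dual, maps egg onto egg). CONCLUSION: the registered signature — for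
three-real-root integral cubics pairwise not joined by an egg-regular coprime datum, a vanishing
`ℚ`-combination of the egg periods `∫_egg dx/√P` and egg quasi-periods `∫_egg x dx/√P` is trivial.
PROOF: real period lattices, `Ω_egg = Ω₀`, `H_egg = −η(Ω₀)` (this file and its companion), the
isotypic splitting `HuberWustholzIsotypicSplitting_of_manyCurvePeriods` (tree, from (1)), then
(3) to exclude rational multipliers inside the class and (2) to conclude.
[cite: HuberWustholz2022, Thm. 15.3 (1),(3) p. 145 with §15.2.2; BakerWustholz2007 §6.2 Thm. 6.4; Masser1975 Ch. II Thm. II, Ch. III Thm. III] -/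
theorem stub_etaIndependence_of : Literature.NumberTheory.Transcendental.HuberWustholzManyCurvePeriods → (∀ (k : ℕ) (S : Finset (Fin k)) (L : Fin k → PeriodPair) (a b : Fin k → ℤ) (p q : Fin k → ℚ), (∀ j ∈ S, (∃ r : ℚ, (r : ℂ) = (L j).g₂) ∧ (∃ r : ℚ, (r : ℂ) = (L j).g₃)) → (∀ j ∈ S, ((a j : ℂ) * (L j).ω₁ + (b j : ℂ) * (L j).ω₂).im = 0 ∧ (a j : ℂ) * (L j).ω₁ + (b j : ℂ) * (L j).ω₂ ≠ 0) → (∀ i ∈ S, ∀ j ∈ S, (L i).IsIsogenousTo (L j)) → (∀ i ∈ S, ∀ j ∈ S, i ≠ j → ¬ ∃ c : ℚ, c ≠ 0 ∧ ∀ l ∈ (L i).lattice, (c : ℂ) * l ∈ (L j).lattice) → ∑ j ∈ S, ((p j : ℂ) * ((a j : ℂ) * (L j).ω₁ + (b j : ℂ) * (L j).ω₂) + (q j : ℂ) * ((a j : ℂ) * (L j).η₁ + (b j : ℂ) * (L j).η₂)) = 0 → ∀ j ∈ S, p j = 0 ∧ q j = 0) → (∀ (A B A' B' : ℤ), 4 *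 A ^ 3 + 27 * B ^ 2 < 0 → 4 * A' ^ 3 + 27 * B' ^ 2 < 0 → ∀ (L L' : PeriodPair) (c : ℚ), L.g₂ = -4 * (A : ℂ) → L.g₃ = -4 * (B : ℂ) → L'.g₂ = -4 * (A' : ℂ) → L'.g₃ = -4 * (B' : ℂ) → c ≠ 0 → (∀ l ∈ L.lattice, (c : ℂ) * l ∈ L'.lattice) → (∃ (f g : Polynomial ℚ) (c : ℚ), IsCoprime f g ∧ Polynomial.derivative f * g - f * Polynomial.derivative g ≠ 0 ∧ Polynomial.C (c ^ 2) * g * (f ^ 3 + Polynomial.C ((A' : ℤ) : ℚ) * f * g ^ 2 + Polynomial.C ((B' : ℤ) : ℚ) * g ^ 3) = (Polynomial.X ^ 3 + Polynomial.C ((A : ℤ) : ℚ) * Polynomial.X + Polynomial.C ((B : ℤ) : ℚ)) * (Polynomial.derivative f * g - f * Polynomial.derivative g) ^ 2 ∧ ∀ y ∈ closure ({y : ℝ | 0 < y ^ 3 + (A : ℝ) * y + (B : ℝ)} \ connectedComponentIn {y : ℝ | 0 < y ^ 3 + (A : ℝ) * y + (B : ℝ)} (1 + |(A : ℝ)| +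 |(B : ℝ)|)), Polynomial.aeval y g ≠ 0) ∨ (∃ (f g : Polynomial ℚ) (c : ℚ), IsCoprime f g ∧ Polynomial.derivative f * g - f * Polynomial.derivative g ≠ 0 ∧ Polynomial.C (c ^ 2) * g * (f ^ 3 + Polynomial.C ((A : ℤ) : ℚ) * f * g ^ 2 + Polynomial.C ((B : ℤ) : ℚ) * g ^ 3) = (Polynomial.X ^ 3 + Polynomial.C ((A' : ℤ) : ℚ) * Polynomial.X + Polynomial.C ((B' : ℤ) : ℚ)) * (Polynomial.derivative f * g - f * Polynomial.derivative g) ^ 2 ∧ ∀ y ∈ closure ({y : ℝ | 0 < y ^ 3 + (A' : ℝ) * y + (B' : ℝ)} \ connectedComponentIn {y : ℝ | 0 < y ^ 3 + (A' : ℝ) * y + (B' : ℝ)} (1 + |(A' : ℝ)| + |(B' : ℝ)|)), Polynomial.aeval y g ≠ 0)) → ∀ (k : ℕ) (A B : Fin k → ℤ) (p q : Fin k → ℚ), (∀ i, 4 * A i ^ 3 + 27 * B i ^ 2 < 0) → (∀ i j, i ≠ j → ¬ ∃ (f g : Polynomial ℚ) (c : ℚ), IsCoprime f g ∧ Polynomial.derivative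 f * g - f * Polynomial.derivative g ≠ 0 ∧ Polynomial.C (c ^ 2) * g * (f ^ 3 + Polynomial.C ((A j : ℤ) : ℚ) * f * g ^ 2 + Polynomial.C ((B j : ℤ) : ℚ) * g ^ 3) = (Polynomial.X ^ 3 + Polynomial.C ((A i : ℤ) : ℚ) * Polynomial.X + Polynomial.C ((B i : ℤ) : ℚ)) * (Polynomial.derivative f * g - f * Polynomial.derivative g) ^ 2 ∧ ∀ y ∈ closure ({y : ℝ | 0 < y ^ 3 + (A i : ℝ) * y + (B i : ℝ)} \ connectedComponentIn {y : ℝ | 0 < y ^ 3 + (A i : ℝ) * y + (B i : ℝ)} (1 + |(A i : ℝ)| + |(B i : ℝ)|)), Polynomial.aeval y g ≠ 0) → ∑ i, ((p i : ℝ) * (∫ x in {x : Fin 1 → ℝ | x 0 ∈ {y : ℝ | 0 < y ^ 3 + (A i : ℝ) * y + (B i : ℝ)} \ connectedComponentIn {y : ℝ | 0 < y ^ 3 + (A i : ℝ) * y + (B i : ℝ)} (1 + |(A i : ℝ)| + |(B i : ℝ)|)}, 1 / Real.sqrt (x 0 ^ 3 + (A i : ℝ) * x 0 + (B i : ℝ)))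 + (q i : ℝ) * (∫ x in {x : Fin 1 → ℝ | x 0 ∈ {y : ℝ | 0 < y ^ 3 + (A i : ℝ) * y + (B i : ℝ)} \ connectedComponentIn {y : ℝ | 0 < y ^ 3 + (A i : ℝ) * y + (B i : ℝ)} (1 + |(A i : ℝ)| + |(B i : ℝ)|)}, x 0 / Real.sqrt (x 0 ^ 3 + (A i : ℝ) * x 0 + (B i : ℝ)))) = 0 → ∀ i, p i = 0 ∧ q i = 0 := by
  intro hHW hClass hBridge k A B p q hdisc hnd hsum i
  classical
  have hns : ∀ j, 4 * A j ^ 3 + 27 * B j ^ 2 ≠ 0 := fun j => (hdisc j).ne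
  -- the real period lattices `Λⱼ` and the integer coordinates of `Ω₀ⱼ ∈ Λⱼ`
  choose L hg₂ hg₃ hreal _hΩ using fun j => ClassReduction.exists_periodPair (hns j)
  choose a b hab using fun j => PeriodPair.mem_lattice.1 (hreal j).minRealPeriod_mem_lattice
  -- the values of the egg integrals
  have hΩ : ∀ j, (∫ x in {x : Fin 1 → ℝ | x 0 ∈ {y : ℝ | 0 < y ^ 3 + (A j : ℝ) * y + (B j : ℝ)} \
      connectedComponentIn {y : ℝ | 0 < y ^ 3 + (A j : ℝ) * y + (B j : ℝ)}
        (1 + |(A j : ℝ)| + |(B j : ℝ)|)},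
      1 / Real.sqrt (x 0 ^ 3 + (A j : ℝ) * x 0 + (B j : ℝ))) = (L j).minRealPeriod :=
    fun j => egg_integral_inv_sqrt (hdisc j) (hg₂ j) (hg₃ j) (hreal j)
  obtain ⟨H, hH⟩ : ∃ H : Fin k → ℝ, ∀ j,
      (∫ x in {x : Fin 1 → ℝ | x 0 ∈ {y : ℝ | 0 < y ^ 3 + (A j : ℝ) * y + (B j : ℝ)} \
        connectedComponentIn {y : ℝ | 0 < y ^ 3 + (A j : ℝ) * y + (B j : ℝ)}
          (1 + |(A j : ℝ)| + |(B j : ℝ)|)},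
        x 0 / Real.sqrt (x 0 ^ 3 + (A j : ℝ) * x 0 + (B j : ℝ))) = H j := ⟨_, fun _ => rfl⟩
  have hH' : ∀ j, ((H j : ℝ) : ℂ) = -((a j : ℂ) * (L j).η₁ + (b j : ℂ) * (L j).η₂) := by
    intro j
    rw [← hH j]
    exact egg_integral_mul_inv_sqrt (hdisc j) (hg₂ j) (hg₃ j) (hreal j) (hab j)
  simp only [hΩ, hH] at hsum
  -- the relation in `ℂ`, in the shape of the isotypic splitting
  have hrel : ∑ j, (((p j * a j : ℚ) : ℂ) * (L j).ω₁ + ((p j * b j : ℚ) : ℂ) * (L j).ω₂ +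
      ((-(q j * a j) : ℚ) : ℂ) * (L j).η₁ + ((-(q j * b j) : ℚ) : ℂ) * (L j).η₂) = 0 := by
    have h0 := congrArg (fun r : ℝ => (r : ℂ)) hsum
    simp only [Complex.ofReal_sum, Complex.ofReal_add, Complex.ofReal_mul, Complex.ofReal_ratCast,
      Complex.ofReal_zero, hH'] at h0
    rw [← h0]
    refine Finset.sum_congr rfl fun j _ => ?_
    rw [← hab j]
    push_cast
    ring
  have hLalg : ∀ j, IsAlgebraic ℚ (L j).g₂ ∧ IsAlgebraic ℚ (L j).g₃ := by
    intro j
    refine ⟨?_, ?_⟩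
    · have e : (L j).g₂ = ((-4 * A j : ℤ) : ℂ) := by rw [hg₂ j]; push_cast; ring
      rw [e]; exact isAlgebraic_int _
    · have e : (L j).g₃ = ((-4 * B j : ℤ) : ℂ) := by rw [hg₃ j]; push_cast; ring
      rw [e]; exact isAlgebraic_int _
  -- the isotypic splitting along the lattice-isogeny class `S` of `i`
  set S : Finset (Fin k) := Finset.univ.filter (fun j => (L i).IsIsogenousTo (L j)) with hSdef
  have hS : ∀ j, j ∈ S ↔ (L i).IsIsogenousTo (L j) := by
    intro j
    simp [hSdef]
  have hsum0 : (0 : ℂ) + 0 * (2 * Real.pi * Complex.I) +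
      ∑ j, (((p j * a j : ℚ) : ℂ) * (L j).ω₁ + ((p j * b j : ℚ) : ℂ) * (L j).ω₂ +
        ((-(q j * a j) : ℚ) : ℂ) * (L j).η₁ + ((-(q j * b j) : ℚ) : ℂ) * (L j).η₂) = 0 := by
    simpa only [zero_mul, add_zero, zero_add] using hrel
  have hblock := (HuberWustholzIsotypicSplitting_of_manyCurvePeriods hHW k L hLalg 0 0
    (fun j => ((p j * a j : ℚ) : ℂ)) (fun j => ((p j * b j : ℚ) : ℂ))
    (fun j => ((-(q j * a j) : ℚ) : ℂ)) (fun j => ((-(q j * b j) : ℚ) : ℂ))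
    isAlgebraic_zero isAlgebraic_zero
    (fun j => ⟨isAlgebraic_rat ℚ _, isAlgebraic_rat ℚ _, isAlgebraic_rat ℚ _, isAlgebraic_rat ℚ _⟩)
    hsum0).2.2 i S hS
  have hblock' : ∑ j ∈ S, ((p j : ℂ) * ((a j : ℂ) * (L j).ω₁ + (b j : ℂ) * (L j).ω₂) +
      (((-q j : ℚ)) : ℂ) * ((a j : ℂ) * (L j).η₁ + (b j : ℂ) * (L j).η₂)) = 0 := by
    rw [← hblock]
    refine Finset.sum_congr rfl fun j _ => ?_
    push_cast
    ring
  -- hypotheses of the class independence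
  have hrat : ∀ j ∈ S, (∃ r : ℚ, (r : ℂ) = (L j).g₂) ∧ (∃ r : ℚ, (r : ℂ) = (L j).g₃) :=
    fun j _ => ⟨⟨-4 * A j, by rw [hg₂ j]; push_cast; ring⟩, ⟨-4 * B j, by rw [hg₃ j]; push_cast; ring⟩⟩
  have hper : ∀ j ∈ S, ((a j : ℂ) * (L j).ω₁ + (b j : ℂ) * (L j).ω₂).im = 0 ∧
      (a j : ℂ) * (L j).ω₁ + (b j : ℂ) * (L j).ω₂ ≠ 0 := by
    intro j _
    rw [hab j]
    exact ⟨Complex.ofReal_im _, by exact_mod_cast (hreal j).minRealPeriod_pos.ne'⟩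
  have hiso : ∀ i' ∈ S, ∀ j ∈ S, (L i').IsIsogenousTo (L j) :=
    fun i' hi' j hj => ((hS i').1 hi').symm.trans ((hS j).1 hj)
  have hnrm : ∀ i' ∈ S, ∀ j ∈ S, i' ≠ j →
      ¬ ∃ c : ℚ, c ≠ 0 ∧ ∀ l ∈ (L i').lattice, (c : ℂ) * l ∈ (L j).lattice := by
    rintro i' - j - hij ⟨c, hc, hcl⟩
    rcases hBridge (A i') (B i') (A j) (B j) (hdisc i') (hdisc j) (L i') (L j) c (hg₂ i') (hg₃ i')
      (hg₂ j) (hg₃ j) hc hcl with hd | hd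
    · exact hnd i' j hij hd
    · exact hnd j i' (Ne.symm hij) hd
  have hi : i ∈ S := (hS i).2 (PeriodPair.isIsogenousTo_refl _)
  have hres := hClass k S L a b p (fun j => -q j) hrat hper hiso hnrm hblock' i hi
  exact ⟨hres.1, neg_eq_zero.mp hres.2⟩

end Summit.KontsevichZagierPeriods.IsogenyCertificates.XMapKernelStubs.EtaIndependence

end
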